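import Literature.AlgebraicGeometry.Hironaka2017.S05NegativePart.R008aPNegaCarrier
import Literature.AlgebraicGeometry.Hironaka2017.S13GLUEDDiagram.R015GlobalTails
import Literature.AlgebraicGeometry.Resolution.DifferentialOperators
import Mathlib.Algebra.CharP.Lemmas
import HarnessLib

/-!
# [OURS · L1 W1.2] Frobenius-sandwich negative modules and the tails module built on them (v1: objects + claim schema)

LADDER-RESOLUTION rung L (rescue), cell `res-hironaka` (run/shared/lean/pub/res-hironaka/), slot **W1.2** of
plan/RESCUE-SEED.md §1 L-G1 («FROBENIUS-SANDWICH DIFFERENTIAL OPERATORS: define the negative modules with Diff relative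
to `ρ^e(O_ξ) ⊂ O_ξ` (Cartier contraction Def 3.9, x-Cartier extension Def 3.7 — the §3 engine …) instead of absolute
`Diff_Z`, so `p^k`-th powers are constants and `1` is not manufactured»). AUTHORITY for file name, host item and typer:
plan/SIZED-ASK-L.md §4 paragraph S-s11/S-s12/S-s13 (res-plan-2): «`…CampaignW12SandwichTSharp.lean` (def sandwich Diff
modules over `S03.Def3_7` / `Def3_9` / `Thm3_10` + Prop `CampaignW12SandwichTSharpNoUnit`) … HOST: MarkedTransfer
`--supports stmt-ResolutionOfSingularities-15522` (`HypersurfaceToMarked`) … TYPER / LANES: type-o2». OURS objects,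
SUMMIT-SIDE (director-resolution 2026-08-26T15:23:05Z), statement-only lane, typer res-L1-type-o2. This is v1 = the
OBJECTS and the NO-UNIT property as named `Prop` schemas; the campaign statement proper (`CampaignW12SandwichTSharpNoUnit`
ON THE R05/R08 WITNESS CLASS) is res-L1-s12-plan-1's rank-9 item and is NOT in this file — typed ahead of that hand-over
so that kill test K1.2 (res-L1-k12) and the campaign share one decl.

READING TYPED HERE (one of two; the typer's choice is flagged for the lanes and for s12-plan-1): «Diff relative to
`ρ^e(O) ⊂ O` … so `p^k`-th powers are constants» = the differential operators of `O` RELATIVE TO THE SUBRING `ρ^e(O)`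
(Grothendieck, EGA IV₄ 16.8, the tree's `Resolution.IsDiffOpLE (ρ^e(O)) k`): they are `ρ^e(O)`-linear — the convention
the manuscript itself imposes on the §§11–13 operators, Rem 11.1 p.63 L12–L14 «all the operators should be
`ρ^ℓ(O)`-linear» (typed `S11CoordFree.IsRhoLinear`, row 073; quoted for scope). Under this reading NO new carrier is
needed: row 008's `S05NegativePart.{DD, pTildeNeg, pNega}` take the base ring as a parameter, and this file instantiates
it at `K := ↥(iterateFrobenius O p e).range`. The OTHER reading — operators of `Diff_{ρ^e(O)/𝕂}` extended to `O`
«x-Cartier» (Lem 3.6 Eq. (10) p.9 L26–L33, Def 3.7 p.10 L1–L2; row 024 `S03DiffARNE.IsXCartierExtension`) or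
contracted by `ρ^ℓ` (Def 3.9 Eq. (11) p.10 L7–L13; row 025 `S03DiffARNE.cartierContraction`) — is NOT typed in v1;
s12-plan-1 says whether the campaign wants it as a sibling decl.

HONEST FRAMING. Nothing in this file is a statement of H. Hironaka's manuscript *Resolution of singularities in
positive characteristics* (2017-03-23, [Hironaka2017], lit key `paper:url-3343fd9e678b`), nothing here asserts or
denies any statement of it, and nothing here is progress on resolution of singularities in positive characteristic.
Def 5.1 (p.25 L29–L38 of HOME/lit/layout/p0025.txt, Eq. (36) L35–L36) is TYPED — not asserted — by PARTITION row 008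
(`S05NegativePart`, ring level over an arbitrary commutative base ring `K`); Def 13.2 (p.67 L16–L22: (105) `𝔗♯(Ě) =
(𝔏_0(∞) ∩ ℘posi) + ℘nega`, `𝔗♭(Ě) = ∥𝔗♯(Ě)∥`) by row 015 (`S13GLUEDDiagram.{TSharp, TFlat}`, parameters
`L0inf pposi pnega : S11CoordFree.BlSub O p ℓ`). Whether the re-based modules do the work §§9–16 ask of `℘nega` is the
campaign's question (W1.2 / K1.2), not settled here. Catalogued barrier bounding the slot (RESCUE-SEED W1.2):
`Literature.Barriers.ResolutionOfSingularities.FrobeniusTwistResolution` (regularity does not transport across the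
sandwich); no barrier of the catalogue addresses the ℘-calculus itself. AI transcription/typing is weaker than expert
review.

## Contents (definitions + one `rfl`; no claim about the manuscript)
* `Campaign.sandwichDD`, `Campaign.sandwichPTildeNeg`, `Campaign.sandwichPNega` — Def 5.1's `D(m,a,d)`, `℘̃(E,−a)`,
  `℘nega(E,−a)` with `Diff_{O/ρ^e(O)}` in place of `Diff_{O/K}`: row 008's carrier at `K := ρ^e(O)`
  (`Campaign.sandwichPNega_eq`).
* `Campaign.idealFamilyToBl` — plumbing: a `ℤ`-indexed family of ideals of `O` placed degree-wise into
  `Bl(Z) = O[T;T⁻¹]` as one `ρ^ℓ(O)`-submodule (row 073's `S11CoordFree.inDegree`), so that row 015's parametric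
  `TSharp / TFlat / Cot` can be fed the sandwich family (no typed row builds `℘nega ⊂ Bl(Z)` from Def 5.1's pieces;
  §§11–14 rows take `pnega` as a parameter).
* `Campaign.sandwichNegaBl`, `Campaign.sandwichTSharp`, `Campaign.sandwichTFlat` — the sandwich `℘nega` inside `Bl(Z)`
  and Def 13.2's (105) / `∥·∥` built on it.
* `Campaign.SandwichNegaNoUnit`, `Campaign.SandwichTFlatNoUnit` — the PROPERTY «`1 ∉ …`» as named `Prop`s with all
  parameters explicit — the shape RESCUE-SEED W1.2's kill test asks about («does `T♯ ∌ 1` for the R05/R08 witnesses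
  under the sandwich operators?»); stated, not claimed.
-/

noncomputable section

set_option linter.dupNamespace false -- mandated namespace of this single-conjunct summit

namespace Summit.ResolutionOfSingularities.ResolutionOfSingularities.Theorems.Campaign

open LaurentPolynomial
open Literature.AlgebraicGeometry.Resolution
open Literature.AlgebraicGeometry.Hironaka2017
open Literature.AlgebraicGeometry.Hironaka2017.S11CoordFree (BlSub inDegree)

universe v

variable {O : Type v} [CommRing O] (p : ℕ) [Fact p.Prime] [CharP O p]

/-! ## The sandwich base `ρ^e(O) ⊂ O` and Def 5.1 re-based on it (ring level: `O = O_Z(V)` or `O_{Z,ξ}`) -/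

/-- [OURS · L1 W1.2] replaces the role of Def 5.1's summand `D(m,a,d) = Diff^{(dm+a)}_Z ℘posi(E,dm)` (Eq. (36)
line 2, p.25 L36); NOT a statement of the manuscript. The same summand with the differential operators of `O`
taken RELATIVE TO THE SUBRING `ρ^e(O)` of `p^e`-th powers (`iterateFrobenius O p e`), i.e. row 008's
`S05NegativePart.DD` at base ring `K := ρ^e(O)`: the ideal generated by the `∂ f`, `∂` a differential operator of
`O/ρ^e(O)` of order `≤ dm + a` (`Resolution.IsDiffOpLE`), `f ∈ ℘posi(E,dm)`. Parameters: graded pieces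
`P j = ℘(E,j)` (I-P, row 003), Def 5.1's integer `m`, `a d : ℤ` (junk outside `dm ≥ |a|`, as in row 008).
VACUITY: at `e = 0`, `ρ^0(O) = O` and order-`≤ k` operators of `O/O` are `O`-linear, so the value is expected to
be `℘posi(E,dm)` itself — the parameter `e` is load-bearing, not decorative. [folklore] -/
def sandwichDD (e : ℕ) (P : ℕ → Ideal O) (m : ℕ) (a d : ℤ) : Ideal O :=
  S05NegativePart.DD (↥(iterateFrobenius O p e).range) P m a d

/-- [OURS · L1 W1.2] replaces the role of Def 5.1's `℘̃(E,−a) = Σ_{d∈ℤ, dm≥|a|} D(m,a,d)` (Eq. (36) line 1, p.25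
L33–L35); NOT a statement of the manuscript. Row 008's `S05NegativePart.pTildeNeg` at base ring `K := ρ^e(O)`;
argument `a : ℤ` AS IN ROW 008 (this is the degree-`(−a)` piece). [folklore] -/
def sandwichPTildeNeg (e : ℕ) (P : ℕ → Ideal O) (m : ℕ) (a : ℤ) : Ideal O :=
  S05NegativePart.pTildeNeg (↥(iterateFrobenius O p e).range) P m a

/-- [OURS · L1 W1.2] replaces the role of Def 5.1's `℘nega(E,−a)`, `a ≥ 0` (p.25 L37–L38); NOT a statement of the
manuscript. Row 008's `S05NegativePart.pNega` at base ring `K := ρ^e(O)` — the «Frobenius-sandwich negative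
module» of RESCUE-SEED W1.2. [folklore] -/
def sandwichPNega (e : ℕ) (P : ℕ → Ideal O) (m a : ℕ) : Ideal O :=
  S05NegativePart.pNega (↥(iterateFrobenius O p e).range) P m a

/-- Unfolding: the sandwich negative module IS row 008's carrier at base `ρ^e(O)` (by `rfl`). [folklore] -/
theorem sandwichPNega_eq (e : ℕ) (P : ℕ → Ideal O) (m a : ℕ) :
    sandwichPNega p e P m a = S05NegativePart.pTildeNeg (↥(iterateFrobenius O p e).range) P m (a : ℤ) :=
  rfl

/-! ## Plumbing into `Bl(Z) = O[T;T⁻¹]` and Def 13.2 on the sandwich family -/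

variable {p}

/-- Plumbing (OURS, no printed counterpart): a `ℤ`-indexed family of ideals `N i ⊂ O = Bl(Z,i)` placed degree-wise
into `Bl(Z) = O[T;T⁻¹]` as ONE `ρ^ℓ(O)`-submodule, `⨆_i inDegree i (N i)` (row 073's `S11CoordFree.inDegree`; an
ideal of `O` is restricted to the scalars `ρ^ℓ(O)`). Used to feed row 015's parametric `TSharp/TFlat/Cot`.
[folklore] -/
def idealFamilyToBl {ℓ : ℕ} (N : ℤ → Ideal O) : BlSub O p ℓ :=
  ⨆ i : ℤ, inDegree i ((N i).restrictScalars (↥(iterateFrobenius O p ℓ).range))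

/-- [OURS · L1 W1.2] replaces the role of `℘nega(Ě) = ⨁_{a>0} ℘nega(Ě,−a) ⊂ Bl(Z)` (Def 5.1 p.25 L38) as the
second summand of Def 13.2 (105) (p.67 L17); NOT a statement of the manuscript. The sandwich pieces
`sandwichPNega p e P m a`, `a > 0`, placed in degrees `−a` of `Bl(Z)` (degrees `≥ 0` get `⊥`). [folklore] -/
def sandwichNegaBl (ℓ e : ℕ) (P : ℕ → Ideal O) (m : ℕ) : BlSub O p ℓ :=
  idealFamilyToBl fun i : ℤ => if i < 0 then sandwichPNega p e P m i.natAbs else ⊥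

/-- [OURS · L1 W1.2] replaces the role of Def 13.2 Eq. (105) `𝔗♯(Ě) = (𝔏_0(∞) ∩ ℘posi) + ℘nega` (p.67 L16–L18);
NOT a statement of the manuscript. Row 015's `S13GLUEDDiagram.TSharp` with its `pnega` parameter instantiated by
the sandwich family `sandwichNegaBl`; `L0inf` («𝔏_0(∞)») and `pposi` («℘posi(Ě)» inside `Bl(Z)`) stay parameters
exactly as in row 015. [folklore] -/
def sandwichTSharp (ℓ e : ℕ) (L0inf pposi : BlSub O p ℓ) (P : ℕ → Ideal O) (m : ℕ) : BlSub O p ℓ :=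
  S13GLUEDDiagram.TSharp L0inf pposi (sandwichNegaBl ℓ e P m)

/-- [OURS · L1 W1.2] replaces the role of Def 13.2 `𝔗♭(Ě) = ∥𝔗♯(Ě)∥ ⊂ O_Z` (p.67 L19); NOT a statement of the
manuscript. Row 015's `S13GLUEDDiagram.TFlat` (degree-forgotten image, row 076's `fnorm`) on the sandwich
family. [folklore] -/
def sandwichTFlat (ℓ e : ℕ) (L0inf pposi : BlSub O p ℓ) (P : ℕ → Ideal O) (m : ℕ) :
    Submodule (↥(iterateFrobenius O p ℓ).range) O :=
  S13GLUEDDiagram.TFlat L0inf pposi (sandwichNegaBl ℓ e P m)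

/-! ## The property the slot asks about, as named `Prop`s (stated, not claimed) -/

variable (p)

/-- [OURS · L1 W1.2] the NO-UNIT property of the sandwich negative modules at the given data: for every `a > 0`,
`1 ∉ ℘nega_sandwich(E,−a)` (equivalently the ideal is proper). RESCUE-SEED W1.2 lever «`p^k`-th powers are
constants and `1` is not manufactured»; whether it holds for the campaign's instances (chart rings of the R05/R08
witnesses under (37)) is kill test K1.2 / the s12 campaign — NOT asserted here. VACUITY: neither trivially true
nor trivially false as typed — at `e = 0` (`ρ^0(O) = O`, order-`≤ k` operators of `O/O` are `O`-linear) each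
`sandwichPNega p 0 P m a` is expected to be `⨆_{d ≥ 1} ℘posi(E,dm)`, proper iff `℘(E,m) ≠ O`; the campaign's content
lies in `e ≥ 1` on rings where the absolute modules are the unit ideal. [folklore] -/
def SandwichNegaNoUnit (e : ℕ) (P : ℕ → Ideal O) (m : ℕ) : Prop :=
  ∀ a : ℕ, 0 < a → (1 : O) ∉ sandwichPNega p e P m a

variable {p}

/-- [OURS · L1 W1.2] the NO-UNIT property for the flat tails module built on the sandwich family: `1 ∉ 𝔗♭`
(RESCUE-SEED W1.2 kill test «does `T♯ ∌ 1` for the R05/R08 witnesses under the sandwich operators?», read through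
`∥·∥`). Parameters as in `sandwichTFlat`. Stated, not claimed. [folklore] -/
def SandwichTFlatNoUnit (ℓ e : ℕ) (L0inf pposi : BlSub O p ℓ) (P : ℕ → Ideal O) (m : ℕ) : Prop :=
  (1 : O) ∉ sandwichTFlat ℓ e L0inf pposi P m

/-! ## v2 (append-only): the slot's STRUCTURAL STATEMENTS «Frobenius-extended ideals are sandwich-stable», and
## the campaign Props in CRITERION form

Everything above this line is byte-identical with v1 (p461383, sha16 7b172524fac86b5d; OURS-DESK #8 CLOSED: lane A
10/10 res-L1-ref-a2 2026-08-26T19:02:42Z, lane B 10/10 res-L1-ref-b1 20:37:36Z). Appended 2026-08-26 ~21:00Z by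
res-L1-type-o2 (g2). PROVENANCE. The campaign prover res-L1-s12-pv-1 (WAKE-s12 19:35:37Z; L/s12/CAMPAIGN.md absent,
res-L1-s12-plan-1 not yet seated) announced on HOME/STATUS.md 2026-08-26T20:17:38Z the signature it proves against —
`∀ (Q : Ideal O), (∃ S ⊆ Set.range (iterateFrobenius O p e), Q = Ideal.span S) → (1:O) ∉ Q → (∀ j, 0 < j → P j ≤ Q) →
Campaign.SandwichNegaNoUnit p e P m` «(+ TFlat analogue)» — and LANDED the proofs as implications over the v1 objects
(p467195 ACCEPTED 20:35:45Z, `Theorems/MarkedTransferCampaignW12SandwichFrobeniusConstants.lean`, ns `….Campaign.W12`: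
`sandwichNegaNoUnit_of_span`, `sandwichNegaNoUnit_of_le_frobeniusPower`, `sandwichTFlatNoUnit_of_span`,
`sandwichTFlatNoUnit_of_le_frobeniusPower`, sharpness `not_sandwichPNega_le` / `pow_le_of_le_frobeniusPower`), with the
line (20:45:02Z) «to res-L1-s12-plan-1: the provable campaign Prop is the CRITERION form (class hypothesis ‹℘(E,j) ⊆
M^{[p^e]}, j > 0› explicit); a blanket ‹NoUnit on the R05/R08 class› is false-type on R05 #1 at e = 1 (k12 disclosure:
∂^{(1,1,1)} g = ω₁⁴ + 1) — file `CampaignW12SandwichTSharpNoUnit` with the class hypothesis». TWO-LANE RULE (L/README): the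
named OURS STATEMENTS live in this lane-signed file; their closures `…_holds` are the prover's one-liners over p467195.
Kill test K1.2 (res-L1-k12, REGISTERED 19:41:04Z) is the instance `M := 𝔪_ξ`, `p^e := q` («box criterion»); its
registered ALIVE criterion bears only on the pieces `℘(E, d·m)`, `d ≥ 1`, that Def 5.1's `D(m,a,d) = Diff^{(dm+a)}
℘posi(E,dm)` consumes (Eq. (36) line 2 p.25 L36; row 008 `DD K P m a d = diffIdeal K (dm+a) (pPosi P (dm))`,
`pPosi P 0 = ⊥`) — whence the sibling `…Mul` below (typer's observation, no side taken: `∀ j > 0, ℘(E,j) ⊆ Q` also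
constrains the pieces `℘(E,j)`, `0 < j < m`, which Def 5.1 never reads and which are LARGER than `℘(E,m)` under the
candidate Th 4.5 p.18 L13–L14). Lane-B referee observation carried for the planner (res-L1-ref-b1 20:37:36Z, a reading
about OUR objects, not run in Lean): in characteristic `p` an absolute operator of order `< p^e` is already
`ρ^e(O)`-linear, so the sandwich restricts only the summands of order `≥ p^e`.

HONEST FRAMING (as for v1): OURS statements about OUR objects (`Campaign.sandwichPNega`, `…sandwichTFlat`); they
replace the role that GAP row R01 (VERDICT ENTERED 2026-08-26T19:30:12Z, fold #21: Def 5.1 / (37)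
DOES-NOT-FOLLOW-AS-PRINTED, class DEFECT — «is `℘̃(E,−a)_ξ` proper for `a ≥ 0`?», p.25 L33–L38 with (37) p.26) denies to
the printed modules, for the SANDWICH modules on the class of data named in the hypotheses; NOT statements of the
manuscript; STATED here, not claimed. Barrier bounding the slot (RESCUE-SEED W1.2):
`Literature.Barriers.ResolutionOfSingularities.FrobeniusTwistResolution` — properness of the sandwich modules transports
no regularity / resolution statement across `ρ^e(O) ⊂ O` (p467195 carries the same line). AI typing is weaker than
expert review.

v3 (2026-08-26 ~22:10Z, res-L1-type-o6 as OVERFLOW typer for res-L1-type-o2, whose pass closed 21:40:33Z): DOCSTRING-ONLY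
over v2 (p468441, sha16 c6343f28685ae577) — every Lean term byte-identical; the docstrings of
`SandwichTFlatNoUnitOfFrobeniusSpan` and `CampaignW12SandwichTSharpNoUnit` no longer attribute their role to «`𝔗 ⊂
[℘̃(Ě)]_{−s}` is a proper module»: lane A (res-L1-ref-a2, BOUNCED-OURS PARTIAL ×2, HOME/STATUS.md 2026-08-26T21:49:44Z)
records that the printed Def 13.2 (1), p.67 L23–L24 («we have a positive integer s such that 𝔗 ⊂ [℘̃(Ě)]_{−s}»), is a
LOWER DEGREE BOUND on the tails — `[W]_s := ⨁_{k ≥ s} W(k)`, §12.0.1 Eq. (99) p.65 L13 — not a properness assertion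
(«proper module» is not printed), and that `1 ∉ 𝔗♭ = ∥𝔗♯∥` neither implies nor follows from (1). The role both decls
replace is restated below as what it is: RESCUE-SEED W1.2's kill-test question «does `T♯ ∌ 1` for the R05/R08 witnesses
under the sandwich operators?» read through `∥·∥` (object: Def 13.2 Eq. (105) / `𝔗♭ = ∥𝔗♯∥`, p.67 L16–L19), i.e. the
NON-COLLAPSE of the tails module that gap row R08 (Def 13.2 `𝔗♯` → Th 14.2 Eq. (108)) needs downstream. -/

variable (p)

/-- [OURS · L1 W1.2, plumbing] «Frobenius-extended ideal»: `Q ⊆ O` is SPANNED BY `p^e`-TH POWERS — `Q = Ideal.span S`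
for some `S ⊆ ρ^e(O) = Set.range (iterateFrobenius O p e)`. Examples: `M^{[p^e]} = M.map (iterateFrobenius O p e)`
(`isFrobeniusSpan_map`; p467195's `W12.map_iterateFrobenius_eq_span`; the tree's
`Literature.RingTheory.TightClosure.frobeniusPower (p^e) M` has the same span form), in particular K1.2's box ideal
`𝔪_ξ^{[q]} = (x_1^q,…,x_n^q)`. = the hypothesis pair `(hS, Q = span S)` of p467195's `…_of_span` theorems, named. No
printed counterpart (OURS). VACUITY: at `e = 0` every ideal qualifies (`ρ^0 = id`); the slot's content is `e ≥ 1`.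
[folklore] -/
def IsFrobeniusSpan (e : ℕ) (Q : Ideal O) : Prop :=
  ∃ S ⊆ Set.range (iterateFrobenius O p e), Q = Ideal.span S

/-- Anchor: the Frobenius power `M^{[p^e]} = M.map ρ^e` of any ideal `M` is a Frobenius-extended ideal (Mathlib's
`Ideal.map f M = Ideal.span (f '' M)`, definitionally). [folklore] -/
theorem isFrobeniusSpan_map (e : ℕ) (M : Ideal O) : IsFrobeniusSpan p e (M.map (iterateFrobenius O p e)) :=
  ⟨iterateFrobenius O p e '' (M : Set O), Set.image_subset_range _ _, rfl⟩

/-- [OURS · L1 W1.2] STRUCTURAL STATEMENT of the slot in SPAN form — the signature announced by res-L1-s12-pv-1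
(2026-08-26T20:17:38Z) with its hypothesis named `IsFrobeniusSpan`: for every Frobenius-extended PROPER ideal `Q`
(`1 ∉ Q`) containing all positive pieces `℘(E,j)`, `j > 0`, NO sandwich negative module `℘nega_sandwich(E,−a)`, `a > 0`,
contains `1` (`SandwichNegaNoUnit p e P m`). Replaces the role of «`℘nega(E,−a)_ξ ⊊ O_ξ`» (the properness GAP row R01
asks of Def 5.1 p.25 L33–L38 under (37) p.26) for the sandwich modules; NOT a statement of the manuscript; stated, not
claimed — closed by p467195's `W12.sandwichNegaNoUnit_of_span` (prover's `_holds` one-liner). VACUITY: hypotheses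
satisfiable non-degenerately (e.g. `O = 𝔽_p[x]`, `e = 1`, `Q = (x^p)`, `P j = (x^p)` for `j > 0`); conclusion not
definitional (quantifies over all `ρ^e(O)`-linear operators of every order); degenerate at `e = 0`. [folklore] -/
def SandwichNegaNoUnitOfFrobeniusSpan (e : ℕ) (P : ℕ → Ideal O) (m : ℕ) : Prop :=
  ∀ Q : Ideal O, IsFrobeniusSpan p e Q → (1 : O) ∉ Q → (∀ j, 0 < j → P j ≤ Q) → SandwichNegaNoUnit p e P m

/-- [OURS · L1 W1.2] sibling of `SandwichNegaNoUnitOfFrobeniusSpan` with the hypothesis restricted to the pieces Def 5.1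
CONSUMES: only `℘posi(E, d·m)`, `d ≥ 1`, enters `D(m,a,d) = Diff^{(dm+a)} ℘posi(E,dm)` (Eq. (36) line 2, p.25 L36; row
008's `pPosi`, `pPosi P 0 = ⊥`), so it suffices that `℘posi(E,dm) ⊆ Q` for all `d ≥ 1` — literally kill test K1.2's
registered ALIVE criterion «`℘(E,dm) ⊆ 𝔪_ξ^{[q]}` for all `d ≥ 1`» at `Q := 𝔪_ξ^{[q]}` (res-L1-k12 2026-08-26T19:41:04Z).
Logically STRONGER than the span form (`sandwichNegaNoUnitOfFrobeniusSpan_of_mul`); closable from p467195's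
`W12.diffIdeal_le_span` summand by summand. NOT a statement of the manuscript; stated, not claimed. [folklore] -/
def SandwichNegaNoUnitOfFrobeniusSpanMul (e : ℕ) (P : ℕ → Ideal O) (m : ℕ) : Prop :=
  ∀ Q : Ideal O, IsFrobeniusSpan p e Q → (1 : O) ∉ Q →
    (∀ d, 0 < d → S05NegativePart.pPosi P (d * m) ≤ Q) → SandwichNegaNoUnit p e P m

/-- Pure logic: the `…Mul` form implies the span form (its hypothesis is weaker: `pPosi P 0 = ⊥`, and
`pPosi P (dm) = P (dm) ≤ Q` when `dm > 0`). [folklore] -/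
theorem sandwichNegaNoUnitOfFrobeniusSpan_of_mul (e : ℕ) (P : ℕ → Ideal O) (m : ℕ)
    (h : SandwichNegaNoUnitOfFrobeniusSpanMul p e P m) : SandwichNegaNoUnitOfFrobeniusSpan p e P m := by
  intro Q hQ h1 hP
  refine h Q hQ h1 fun d _ => ?_
  by_cases hdm : d * m = 0
  · simp [S05NegativePart.pPosi, hdm]
  · simpa [S05NegativePart.pPosi, hdm] using hP (d * m) (Nat.pos_of_ne_zero hdm)

variable {p}

/-- [OURS · L1 W1.2] STRUCTURAL STATEMENT, `𝔗♭` form in SPAN form (res-L1-s12-pv-1 20:17:38Z «(S4) pposi with all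
coefficients in Q ⇒ SandwichTFlatNoUnit»; shape confirmed «GO — as written, with the coefficient-wise pposi hypothesis»
20:49:17Z): for every Frobenius-extended proper ideal `Q` containing the positive pieces `℘(E,j)`, `j > 0`, and such that
every element of the parameter `pposi` («`℘posi(Ě)` inside `Bl(Z)`», row 015) has ALL its `T`-coefficients in `Q`
(Mathlib's `AddMonoidAlgebra.coeff` on `Bl(Z) = O[T;T⁻¹]`), the sandwich flat tails module `𝔗♭_sandwich = ∥(𝔏_0(∞) ∩
℘posi) + ℘nega_sandwich∥` (Def 13.2 (105)/∥·∥ p.67 L16–L19 on the sandwich family) does not contain `1`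
(`SandwichTFlatNoUnit ℓ e L0inf pposi P m`) — for EVERY `L0inf`. Replaces the role of RESCUE-SEED W1.2's kill-test
question «does `T♯ ∌ 1` … under the sandwich operators?» read through `∥·∥` — the NON-COLLAPSE `1 ∉ 𝔗♭ = ∥𝔗♯∥` of
Def 13.2's tails module (object: Eq. (105) / `∥·∥`, p.67 L16–L19) that gap row R08 (Def 13.2 `𝔗♯` → Th 14.2 Eq. (108))
needs downstream — for the sandwich tails (v3: the v2 attribution to Def 13.2 (1) p.67 L23–L24 is WITHDRAWN: (1) is the
lower degree bound `𝔗 ⊂ [℘̃(Ě)]_{−s}`, `[W]_s := ⨁_{k ≥ s} W(k)` §12.0.1 p.65 L13, not a properness statement, and is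
independent of `1 ∉ 𝔗♭`; lane A 2026-08-26T21:49:44Z); NOT a statement of the manuscript; stated, not claimed
(the prover's `sandwichTFlatNoUnitOfFrobeniusSpan_holds`, «via `Σ_d coeff ∈ Q`»; p467195's
`W12.sandwichTFlatNoUnit_of_span` is the special case `pposi ≤ idealFamilyToBl (j ↦ ℘(E,j))`). VACUITY: as for the
module form; the coefficient hypothesis is satisfiable non-trivially (e.g. `pposi := idealFamilyToBl (j ↦ P j, j > 0)`).
[folklore] -/
def SandwichTFlatNoUnitOfFrobeniusSpan (ℓ e : ℕ) (L0inf pposi : BlSub O p ℓ) (P : ℕ → Ideal O) (m : ℕ) : Prop :=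
  ∀ Q : Ideal O, IsFrobeniusSpan p e Q → (1 : O) ∉ Q → (∀ j, 0 < j → P j ≤ Q) →
    (∀ x ∈ pposi, ∀ d : ℤ, (x : O[T;T⁻¹]).coeff d ∈ Q) → SandwichTFlatNoUnit ℓ e L0inf pposi P m

/-- [OURS · L1 W1.2] **`CampaignW12SandwichNegaNoUnit`**, the slot's campaign Prop in CRITERION form, module version
(res-L1-s12-pv-1 20:45:02Z «the provable campaign Prop is the CRITERION form, class hypothesis ‹℘(E,j) ⊆ M^{[p^e]},
j > 0› explicit»), CLOSED OVER ALL DATA: for every commutative ring `O` of characteristic `p`, level `e`, graded family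
`P` («`P j = ℘(E,j)`»), `m`, and every PROPER ideal `M ⊊ O` with `℘(E,j) ⊆ M^{[p^e]} = M.map ρ^e` for all `j > 0`:
`SandwichNegaNoUnit p e P m`. Kill test K1.2 is the instance `M = 𝔪_ξ`, `p^e = q` at a closed point. Replaces the role
of the properness GAP row R01 denies to Def 5.1's `℘nega(E,−a)_ξ` (p.25 L33–L38, (37) p.26), for the sandwich modules
on the stated class; NOT a statement of the manuscript; stated, not claimed — closable by p467195's
`W12.sandwichNegaNoUnit_of_le_frobeniusPower`. Binders `(p) [Fact p.Prime]` explicit in the signature (a closed statement per prime `p`, as `CampaignW22.TranslationOrderSafe p`); `O : Type v` quantified inside (polymorphic in `v`). VACUITY: the class is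
non-empty and non-degenerate (e.g. `𝔽_p[x]`, `M = (x)`, `e = 1`, `P j = (x^p)`); p467195's `W12.pow_le_of_le_frobeniusPower`
records that at a (37)-point the class hypothesis forces `p^e ≤ m`. [folklore] -/
def CampaignW12SandwichNegaNoUnit (p : ℕ) [Fact p.Prime] : Prop :=
  ∀ (O : Type v) [CommRing O] [CharP O p] (e : ℕ) (P : ℕ → Ideal O) (m : ℕ) (M : Ideal O),
    M ≠ ⊤ → (∀ j, 0 < j → P j ≤ M.map (iterateFrobenius O p e)) → SandwichNegaNoUnit p e P m

/-- [OURS · L1 W1.2] **`CampaignW12SandwichTSharpNoUnit`** — THE SLOT'S CAMPAIGN PROP under the name plan/SIZED-ASK-L.md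
§S-s12 gives it («Prop `CampaignW12SandwichTSharpNoUnit`» = RESCUE-SEED W1.2's question «does `T♯ ∌ 1` … under the
sandwich operators?» read through `∥·∥`), in the CRITERION form res-L1-s12-pv-1 asks the planner to file (20:45:02Z),
CLOSED OVER ALL DATA: for every `O` of characteristic `p`, `ℓ`, `e`, `L0inf` («𝔏_0(∞)»), `pposi` («℘posi(Ě) ⊂ Bl(Z)»),
graded family `P`, `m`, and every proper ideal `M` with `℘(E,j) ⊆ M^{[p^e]}` for all `j > 0` and `pposi` fed by the
pieces (`pposi ≤ idealFamilyToBl (j ↦ P j, j > 0)`): `SandwichTFlatNoUnit ℓ e L0inf pposi P m`, i.e. `1 ∉ 𝔗♭_sandwich`.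
Replaces the role of that seed question — the NON-COLLAPSE `1 ∉ 𝔗♭ = ∥𝔗♯∥` of Def 13.2's tails module (object:
Eq. (105) / `∥·∥`, p.67 L16–L19; the name says `TSharp`, the content is `𝔗♭ = ∥𝔗♯∥`) that gap row R08 (Def 13.2 `𝔗♯` →
Th 14.2 Eq. (108)) needs downstream — for the sandwich tails on the stated class (v3: the v2 attribution to «is a proper
module», Def 13.2 (1) p.67 L23–L24, is WITHDRAWN — (1) is the lower degree bound `[W]_s := ⨁_{k ≥ s} W(k)`, §12.0.1
p.65 L13, not properness; lane A 2026-08-26T21:49:44Z); NOT a statement of the manuscript; stated, not claimed —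
closable by
p467195's `W12.sandwichTFlatNoUnit_of_le_frobeniusPower`. The class hypothesis is EXPLICIT because the blanket form on
«the R05/R08 witness class» is of false type at `e = 1` on R05 #1 (k12 disclosure, pv-1 20:45:02Z); which witnesses
satisfy the hypothesis is K1.2's per-witness certificate, not asserted here. Universe-polymorphic in `v`.
VACUITY: as for `CampaignW12SandwichNegaNoUnit`. [folklore] -/
def CampaignW12SandwichTSharpNoUnit (p : ℕ) [Fact p.Prime] : Prop :=
  ∀ (O : Type v) [CommRing O] [CharP O p] (ℓ e : ℕ) (L0inf pposi : BlSub O p ℓ) (P : ℕ → Ideal O) (m : ℕ)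
    (M : Ideal O), M ≠ ⊤ → (∀ j, 0 < j → P j ≤ M.map (iterateFrobenius O p e)) →
      pposi ≤ idealFamilyToBl (p := p) (fun i : ℤ => if 0 < i then P i.toNat else ⊥) →
        SandwichTFlatNoUnit ℓ e L0inf pposi P m

end Summit.ResolutionOfSingularities.ResolutionOfSingularities.Theorems.Campaign
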